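import Summits.NavierStokesRegularity.FluidComputer.GateBudgetMemberState
import HarnessLib

/-!
# What no tuning can beat, part 32: THE CLOCK LEVEL OF A DOUSED MEMBER — every member of the
# window comes out of its pulse with the clock at `b(T) ≤ -0.69ε`, not merely `-ε/4`

Cell `pub-fluidc`, blueprint seat bp1 (gen 32, second item); same namespace and conventions as
parts 1–31 (`GateBudget*.lean`); imports part 28 (`GateBudgetMemberState`). Modes `0 = a`,
`1 = b` clock, `2 = c` trigger/catalyst, `3 = d` transfer, `4 = ã` output; `w = ε/(Mρ²)` the
winding number, `λ₀ = K⁻¹⁰ + 4e^{-M}/M` the residue level.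
HONEST FRAMING (verbatim): low prior, high value-of-information experiment on Tao's machine
paradigm; NOT a claim that NS blows up.

THE POINT. Part 28 (`knob_member_state`, §81) exports the state of every member at its dousing
time `T` with the clock level `b(T) ≤ -ε/4` — the `β` of part 19's bootstrap — and every cap,
floor and wait of parts 25–30 is timed by that `β` (self-timed window `β/(2ε) = 1/8`). But
part 28's own §80 (`knob_member_levels`) also certifies the RING `b² + c² ≥ (7ε/10)²`
throughout `[s₀, T]`, and at `T` the trigger is a residue, `c(T) ≤ λ₀ρ² ≤ 0.06ε`
(`λ₀ ≤ 2⁻⁴⁰ + 4/133`, `ρ² ≤ ε`); so `b(T)² ≥ 0.49ε² - 0.0036ε² > (0.69ε)²`, and since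
`b(T) ≤ -ε/4 < 0`: `b(T) ≤ -0.69ε` — THE CLOCK OF A DOUSED MEMBER IS DEEP IN DEBT. §92
(`knob_member_state_clock`) is §81 with the two conjuncts `(7ε/10)² ≤ b(T)² + c(T)²` and
`b(T) ≤ -0.69ε` exported (same hypotheses, same proof, nothing dropped); §93
(`knob_member_state_headline_clock`) is §82 (`M = K¹⁰`, window `200ε/K²⁰ ≤ ρ² ≤ 2ε/K¹⁰`) with
`b(T) ≤ -0.69ε` appended. This is the `β = 0.69ε` that makes part 31's debt window
`2β/ε = 1.38` time units long (part 33): the second-pulse exclusion of SPEC (3) past `√2 + 1/8`.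

HONEST LIMITS. (i) Re-export only: the proofs are §81/§82's with part 28's ring level kept —
no new dynamics; §81/§82 stay (parts 29/30 import them). (ii) `0.69` is part 19's ring radius
`ϱ = 7ε/10` minus the residue, not an optimum: the clock enters the pulse at `b(s₀) ≥ 0.99ε`
(indeed `≈ ε·s₀ ≈ √2ε`) and the pulse nearly conserves `b² + c²`, so the true level is near
`-b(s₀)`; certifying `b(T) ≤ -0.99ε` or better needs part 19's bootstrap re-run with a larger
ring, not done here. (iii) Numbers need `K ≥ 16`, `48 log K ≤ M ≤ K¹⁰` (§92) resp. `M = K¹⁰`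
(§93). (iv) Nothing about Navier–Stokes.
[cite: Tao2016AveragedNS, §5.5 Theorem 5.3, (5.5), (5.6), (b-eq), (c-eq), (tcable)]
-/

noncomputable section

namespace Summit.NavierStokesRegularity.FluidComputer.GateBudget

open Real Set Filter Topology
open Literature.Analysis.FluidPDE.Tao2016AveragedNS

variable {K M ε ρ : ℝ} {X : ℝ → Fin 5 → ℝ} {C : ℝ → ℝ}

/-! ## §92 The state of a member, with its clock level -/

/-- **THE STATE OF A MEMBER, WITH ITS CLOCK LEVEL.** Part 28's `knob_member_state` verbatim
(same hypotheses: `0 < ρ² ≤ ε`, `Mρ⁴ ≤ ε²`, `ε = wMρ²`, `16 ≤ K`, `48 log K ≤ M ≤ K¹⁰`,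
`ε² ≤ 1/(6K²⁰)`, `Δ`, `ψ`, `D` as there; same sixteen conclusions: window, levels, exit
brackets) with TWO MORE conclusions at the dousing time `T`: the ring level
`(7ε/10)² ≤ b(T)² + c(T)²` of §80 and the clock level `b(T) ≤ -(69/100)ε` (ring, residue
`c(T) ≤ λ₀ρ² ≤ (3/50)ε`, and `b(T) < 0`).
[cite: Tao2016AveragedNS, §5.5 Theorem 5.3, (5.5), (5.6), (b-eq), (c-eq), (tcable)] -/
theorem knob_member_state_clock
    (hX : ∀ t, HasDerivAt X (RotorKnob.rotorCircuit K M ε ρ (X t)) t)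
    (h0 : X 0 = delayInit) (hε : 0 < ε) (hρ : 0 < ρ) (hρε : ρ ^ 2 ≤ ε)
    (hMρ : M * ρ ^ 4 ≤ ε ^ 2) (hM : 0 < M) (hMK : M ≤ K ^ 10) (hK : 16 ≤ K)
    (hML : 48 * Real.log K ≤ M) (hεK : ε ^ 2 ≤ 1 / (6 * K ^ 20))
    (hC : ∀ t, HasDerivAt C (X t 2) t) (w : ℝ) (hk : ε = w * M * ρ ^ 2)
    {κ P Δ ψ D : ℝ} (hκ : w ≤ κ) (hP : ρ ^ 2 ≤ P)
    (hΔ : 8 * log (25 * ε * K ^ 10 / (8 * ρ ^ 2)) / M + 200 / (169 * M - 400) ≤ Δ)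
    (hH : Δ < 1 / 16)
    (hψ : 6 / (M * K ^ 10) + 16 * exp (-M) / M ^ 2
        + (κ * (π * (100 / (49 * M))) + 10 * exp (-M) * Δ / (7 * M)) / (1 - 100 / (49 * M))
        + 3 / (2 * K ^ 10) ≤ ψ)
    (hD : 6 * (ε + P * exp (-M) + 3 / K ^ 9)
        + 2 * (ε + P * exp (-M) + 3 / K ^ 9 + K ^ 2 * Δ) * Δ ≤ D) :
    ∃ s₀ T : ℝ, 2 - 24 * Real.log K / M ≤ s₀ ^ 2 ∧ s₀ ^ 2 ≤ 2 + 2 / M ∧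
      1 ≤ s₀ ∧ s₀ ≤ 3 / 2 ∧ s₀ < T ∧ T - s₀ ≤ Δ ∧
      X T 1 ≤ -(ε / 4) ∧ X T 2 ≤ (1 / K ^ 10 + 4 * exp (-M) / M) * ρ ^ 2 ∧
      X s₀ 4 ≤ 3 / K ^ 10 ∧ X T 4 ≤ 3 / K ^ 10 + K * Δ ∧
      |X T 0| ≤ |cos (w * π)| + |sin (w * π)| * ψ + D ∧
      |X T 3| ≤ |sin (w * π)| + |cos (w * π)| * ψ + D ∧
      |cos (w * π)| * (1 - ψ ^ 2 / 2) - |sin (w * π)| * ψ - D ≤ |X T 0| ∧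
      |sin (w * π)| * (1 - ψ ^ 2 / 2) - |cos (w * π)| * ψ - D ≤ |X T 3| ∧
      (7 / 10 * ε) ^ 2 ≤ X T 1 ^ 2 + X T 2 ^ 2 ∧ X T 1 ≤ -(69 / 100 * ε) := by
  have hK0 : 0 < K := by linarith
  have hK1 : 1 ≤ K := by linarith
  have hε2 : 0 < ε ^ 2 := by positivity
  -- the winding number is positive
  have hw' : w = ε / (M * ρ ^ 2) := by
    rw [eq_div_iff (by positivity), hk]; ring
  have hw0 : 0 < w := by rw [hw']; positivity
  have hM133 : 133 ≤ M := by
    have h16 : log 16 = 4 * log 2 := by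
      rw [show (16 : ℝ) = 2 ^ 4 by norm_num, Real.log_pow]; norm_num
    have hlogK : log 16 ≤ log K := log_le_log (by norm_num) hK
    linarith [Real.log_two_gt_d9]
  -- the residue level `λ₀ = K⁻¹⁰ + 4e^{-M}/M ≤ 2⁻⁴⁰ + 4/133 ≤ 3/50`
  have hl0 : 1 / K ^ 10 + 4 * exp (-M) / M ≤ 3 / 50 := by
    have h10 : (1099511627776 : ℝ) ≤ K ^ 10 := by
      have := pow_le_pow_left₀ (by norm_num : (0 : ℝ) ≤ 16) hK 10; norm_num at this; exact this
    have hl1 : (1 : ℝ) / K ^ 10 ≤ 1 / 1099511627776 :=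
      div_le_div_of_nonneg_left (by norm_num) (by norm_num) h10
    have hl2 : 4 * exp (-M) / M ≤ 4 / 133 := by
      have he : exp (-M) ≤ 1 := exp_le_one_iff.2 (by linarith)
      rw [div_le_div_iff₀ hM (by norm_num)]
      linarith [mul_le_mul he hM133 (by norm_num) zero_le_one]
    linarith
  -- §80: the window and the levels at the member's own times
  obtain ⟨s₀, T, hsq1, hsq2, hs1, hs32, hsT, hTΔ, hcpos, harm, hbs, hcs, hbT, hcT, hΦ, he₀, heT,
      ha₀, hd₀⟩ :=
    knob_member_levels hX h0 hε hρ hρε hM hMK hK hML hεK hMρ hC (lt_of_le_of_lt hΔ hH)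
  have hTΔ' : T - s₀ ≤ Δ := hTΔ.trans hΔ
  have hs0 : 0 ≤ s₀ := by linarith
  -- the critical ratio is subunit on the window radius `ϱ = 7ε/10`
  have hq : ε ^ 2 < M * (7 / 10 * ε) ^ 2 := by
    have hMε : 133 * ε ^ 2 ≤ M * ε ^ 2 := mul_le_mul_of_nonneg_right hM133 hε2.le
    have h49 : M * (7 / 10 * ε) ^ 2 = 49 / 100 * (M * ε ^ 2) := by ring
    rw [h49]; linarith
  -- the closed forms of the phase budget (part 22b) and of the drift (part 20)
  have hψ' := (winding_psi_le w hw0.le hk hκ hε hρ hM133 hK0 hTΔ').trans hψ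
  have hD' := (lattice_drift_le hK1 hε.le hP hs0 hs32 (by linarith) hTΔ' he₀ heT).trans hD
  -- part 24a §69: the total phase is `wπ` up to the budget; part 25a §73: the sharp exit
  have hη := knob_swing_lower (b₁ := ε / 2) (γ₁ := ρ ^ 2 / K ^ 10) (β := ε / 4)
    (lam₀ := 1 / K ^ 10 + 4 * exp (-M) / M) (by positivity) hbs (hcpos s₀ ⟨le_rfl, hsT.le⟩)
    hcs.le (by positivity) hbT (hcpos T ⟨hsT.le, le_rfl⟩) hcT
  have hph := knob_winding_phase hX h0 hε hρ hM hC w hw0.le hk hsT.le (by positivity) hq hcpos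
    harm hη hΦ
  obtain ⟨⟨hd1, hd2⟩, ha1, ha2⟩ :=
    knob_phase_exit_sharp hX h0 hC hε.le hK0.le hs0 hsT.le (hph.trans hψ')
  -- the output at the dousing time: `ã(T) ≤ ã(s₀) + K(T - s₀) ≤ 3/K¹⁰ + KΔ`
  have heT' : X T 4 ≤ 3 / K ^ 10 + K * Δ := by
    have := mul_le_mul_of_nonneg_left hTΔ' hK0.le
    linarith
  -- the clock level at the dousing time: ring `b² + c² ≥ 0.49ε²`, residue `c ≤ 0.06ε`, `b < 0`
  have hring := harm T ⟨hsT.le, le_rfl⟩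
  have hb69 : X T 1 ≤ -(69 / 100 * ε) := by
    have hc0 : 0 ≤ X T 2 := (hcpos T ⟨hsT.le, le_rfl⟩).le
    have hcε : X T 2 ≤ 3 / 50 * ε :=
      hcT.trans (mul_le_mul hl0 hρε (by positivity) (by norm_num))
    have hc2 : X T 2 ^ 2 ≤ (3 / 50 * ε) ^ 2 := pow_le_pow_left₀ hc0 hcε 2
    by_contra hcon
    rw [not_le] at hcon
    have h3 : X T 1 ^ 2 < (69 / 100 * ε) ^ 2 := by
      apply sq_lt_sq' hcon
      linarith
    linarith [hring, hc2, h3, hε2]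
  exact ⟨s₀, T, hsq1, hsq2, hs1, hs32, hsT, hTΔ', hbT, hcT, he₀, heT', by linarith, by linarith,
    by linarith, by linarith, hring, hb69⟩

/-! ## §93 The state of a member at `M = K¹⁰`, with its clock level -/

/-- **THE STATE OF A MEMBER AT `M = K¹⁰`, WITH ITS CLOCK LEVEL.** Part 28's
`knob_member_state_headline` verbatim (`K ≥ 16`, `0 < ε`, `ε² ≤ 1/(6K²⁰)`, an exact trajectory
of `rotorCircuit K K¹⁰ ε ρ` from (5.6) with `200ε/K²⁰ ≤ ρ² ≤ 2ε/K¹⁰`; fifteen conclusions: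
`2 - 24 log K/K¹⁰ ≤ s₀² ≤ 2 + 2/K¹⁰`, `1 ≤ s₀ ≤ 3/2`, `s₀ < T ≤ s₀ + 242/K⁹`, `b(T) ≤ -ε/4`,
`c(T) ≤ (K⁻¹⁰ + 4e^{-K¹⁰}/K¹⁰)ρ²`, `ã(T) ≤ 10⁻³`, the brackets of `|a(T)|`, `|d(T)|` with
`ψ = 7/100`, `D = 10⁻³`) with ONE MORE: `b(T) ≤ -(69/100)ε` — §92 at `M = K¹⁰`. This is the
`β = 0.69ε` of part 33: debt window `2β/ε = 69/50`.
[cite: Tao2016AveragedNS, §5.5 Theorem 5.3, (5.5), (5.6), (b-eq), (c-eq), (tcable)] -/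
theorem knob_member_state_headline_clock {K ε ρ : ℝ} {X : ℝ → Fin 5 → ℝ} {C : ℝ → ℝ}
    (hX : ∀ t, HasDerivAt X (RotorKnob.rotorCircuit K (K ^ 10) ε ρ (X t)) t)
    (h0 : X 0 = delayInit) (hC : ∀ t, HasDerivAt C (X t 2) t) (hK : 16 ≤ K) (hε : 0 < ε)
    (hεK : ε ^ 2 ≤ 1 / (6 * K ^ 20)) (hρ : 0 < ρ) (hlo : 200 * ε / K ^ 20 ≤ ρ ^ 2)
    (hhi : K ^ 10 * ρ ^ 2 ≤ 2 * ε) :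
    ∃ s₀ T : ℝ, 2 - 24 * Real.log K / K ^ 10 ≤ s₀ ^ 2 ∧ s₀ ^ 2 ≤ 2 + 2 / K ^ 10 ∧
      1 ≤ s₀ ∧ s₀ ≤ 3 / 2 ∧ s₀ < T ∧ T - s₀ ≤ 242 / K ^ 9 ∧
      X T 1 ≤ -(ε / 4) ∧ X T 2 ≤ (1 / K ^ 10 + 4 * exp (-K ^ 10) / K ^ 10) * ρ ^ 2 ∧
      X T 4 ≤ 1 / 1000 ∧
      |X T 0| ≤ |cos (ε / (K ^ 10 * ρ ^ 2) * π)|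
          + 7 / 100 * |sin (ε / (K ^ 10 * ρ ^ 2) * π)| + 1 / 1000 ∧
      |X T 3| ≤ |sin (ε / (K ^ 10 * ρ ^ 2) * π)|
          + 7 / 100 * |cos (ε / (K ^ 10 * ρ ^ 2) * π)| + 1 / 1000 ∧
      19951 / 20000 * |cos (ε / (K ^ 10 * ρ ^ 2) * π)|
          - 7 / 100 * |sin (ε / (K ^ 10 * ρ ^ 2) * π)| - 1 / 1000 ≤ |X T 0| ∧
      19951 / 20000 * |sin (ε / (K ^ 10 * ρ ^ 2) * π)|
          - 7 / 100 * |cos (ε / (K ^ 10 * ρ ^ 2) * π)| - 1 / 1000 ≤ |X T 3| ∧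
      X T 1 ≤ -(69 / 100 * ε) := by
  have hK0 : 0 < K := by linarith
  have hK10 : 0 < K ^ 10 := by positivity
  have h8 : (4294967296 : ℝ) ≤ K ^ 8 := by
    have := headline_pow_floor hK 8; norm_num at this; exact this
  have h9 : (68719476736 : ℝ) ≤ K ^ 9 := by
    have := headline_pow_floor hK 9; norm_num at this; exact this
  have h10 : (1099511627776 : ℝ) ≤ K ^ 10 := by
    have := headline_pow_floor hK 10; norm_num at this; exact this
  have hH : (242 : ℝ) / K ^ 9 < 1 / 16 := by
    rw [div_lt_div_iff₀ (by positivity) (by norm_num)]; linarith [h9]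
  have hΔ0 : (0 : ℝ) ≤ 242 / K ^ 9 := by positivity
  -- the member's winding number `w = ε/(K¹⁰ρ²) ≤ κ := 2w`, and `20ε/K²⁰ ≤ 200ε/K²⁰ ≤ ρ²`
  have hk : ε = ε / (K ^ 10 * ρ ^ 2) * K ^ 10 * ρ ^ 2 := by
    field_simp
  have hκ : ε / (K ^ 10 * ρ ^ 2) ≤ 2 * ε / (K ^ 10 * ρ ^ 2) :=
    div_le_div_of_nonneg_right (by linarith) (by positivity)
  have hlo20 : 20 * ε / K ^ 20 ≤ ρ ^ 2 :=
    le_trans (div_le_div_of_nonneg_right (by linarith) (by positivity)) hlo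
  -- `ρ² ≤ 2ε/K¹⁰ ≤ ε` and `K¹⁰ρ⁴ ≤ 2ερ² ≤ 4ε²/K¹⁰ ≤ ε²`
  have hρε : ρ ^ 2 ≤ ε := by nlinarith [sq_nonneg ρ]
  have hMρ : K ^ 10 * ρ ^ 4 ≤ ε ^ 2 := by
    have h1 : K ^ 10 * ρ ^ 4 = (K ^ 10 * ρ ^ 2) * ρ ^ 2 := by ring
    have h2 : K ^ 10 * ρ ^ 4 ≤ 2 * ε * ρ ^ 2 := by
      rw [h1]; exact mul_le_mul_of_nonneg_right hhi (sq_nonneg ρ)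
    have h3 : K ^ 10 * (2 * ε * ρ ^ 2) ≤ 2 * ε * (2 * ε) := by nlinarith
    nlinarith
  -- the numerics of parts 21 and 23: `ψ = 7/100`, `D = 10⁻³`
  have hψ := teeth_psi hK hε hlo hΔ0 (by linarith : (242 : ℝ) / K ^ 9 ≤ 1)
  have hD := headline_drift hK hεK hhi
  obtain ⟨s₀, T, hsq1, hsq2, hs1, hs2, hsT, hTs, hbT, hcT, -, heT, ha1, hd1, ha2, hd2, -, hb69⟩ :=
    knob_member_state_clock hX h0 hε hρ hρε hMρ hK10 le_rfl hK (headline_trigger hK) hεK hC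
      (ε / (K ^ 10 * ρ ^ 2)) hk (P := ρ ^ 2) hκ le_rfl (profile_delta hK hε hρ hlo20) hH hψ hD
  have e2 : (1 - (7 / 100 : ℝ) ^ 2 / 2) = 19951 / 20000 := by norm_num
  rw [e2] at ha2 hd2
  -- the output at the dousing time: `3/K¹⁰ + K·242/K⁹ = 3/K¹⁰ + 242/K⁸ ≤ 10⁻³`
  have heT' : X T 4 ≤ 1 / 1000 := by
    have h1 : K * (242 / K ^ 9) = 242 / K ^ 8 := by
      field_simp
    have h2 : (3 : ℝ) / K ^ 10 ≤ 3 / 1099511627776 :=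
      div_le_div_of_nonneg_left (by norm_num) (by norm_num) h10
    have h3 : (242 : ℝ) / K ^ 8 ≤ 242 / 4294967296 :=
      div_le_div_of_nonneg_left (by norm_num) (by norm_num) h8
    rw [h1] at heT
    linarith
  exact ⟨s₀, T, hsq1, hsq2, hs1, hs2, hsT, hTs, hbT, hcT, heT', by linarith, by linarith,
    by linarith, by linarith, hb69⟩

end Summit.NavierStokesRegularity.FluidComputer.GateBudget
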